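import Literature.Analysis.FunctionSpaces.LatticeEllipticRegularity
import Literature.Analysis.FunctionSpaces.TorusCutoffSymbols
import Literature.Analysis.FunctionSpaces.LatticeDiffOpAdjoint
import Literature.Analysis.FunctionSpaces.LatticeSobolevSmooth
import Literature.Analysis.FunctionSpaces.TorusSobolevNorm
import HarnessLib

/-!
# Local regularity of weak solutions on the lattice (Warner 6.32 (9)–(16))

F. W. Warner, GTM 94 (1983), 6.32, equations (9)–(16): if `ũ ∈ H₀` solves `L̃ũ = f` weakly on a
neighbourhood `O₀` (`⟨ũ, L*φ⟩ = ⟨f, φ⟩` for test functions supported in `O₀`) and `ω_n` is a chain of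
plateau cut-offs in `O₀`, then `v_n = ω_n ũ ∈ H_n` for every `n` (bootstrap through the periodic
regularity theorem 6.30 with `L̃(ω u) = ω L̃u + [L̃, ω]u` and the locality `M₂ũ = M₂v₁`), hence
`wInf ũ` is smooth for a plateau `wInf` inside all `O_n` (corollary to Sobolev's lemma 6.22).

We prove this for an elliptic lattice operator `L` (`Lattice.POp` with small principal perturbation),
an abstract "adjoint witness" `Lw` with `⟨L u, v⟩ = ⟨u, Lw v⟩` (in the application `L` is the flat
adjoint of the torus Laplacian and `Lw` the Laplacian itself), real cut-offs `ω_j` forming plateau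
pairs (`Torus.PlateauPair`), and the weak equation on test functions supported in `tsupport w₀`:
`local_regularity` (`v_{j+1} ∈ H_{j+1}`) and `exists_isSmooth_plateau_conv`.

## References

* F. W. Warner, GTM 94 (1983), 6.32 (9)–(16), 6.30, 6.22. [WarnerGTM94]
-/

noncomputable section

open Filter Finset Function Set
open scoped ENNReal NNReal Topology InnerProductSpace ComplexConjugate

namespace Literature.Analysis.FunctionSpaces

namespace Lattice

open Torus UnitAddTorus

variable {d : Type*} [Fintype d] [DecidableEq d]
variable {V : Type*} [NormedAddCommGroup V] [InnerProductSpace ℂ V] [CompleteSpace V]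

/-! ### Real cut-offs: the adjoint symbol of a real scalar cut-off is itself -/

omit [DecidableEq d] in
/-- For a real cut-off `ω = θ + 0i`, `(scal 𝓕ω)† = scal 𝓕ω` (`conj 𝓕θ(-k) = 𝓕θ(k)`). [folklore] -/
theorem adjSymb_scal_ofReal (θ : UnitAddTorus d → ℝ) :
    adjSymb (scal (mFourierCoeff fun x => (θ x : ℂ)) : (d → ℤ) → (V →L[ℂ] V)) = scal (mFourierCoeff fun x => (θ x : ℂ)) := by
  funext k
  rw [adjSymb_apply, scal_apply, scal_apply, mFourierCoeff_ofReal_comp θ k, LinearIsometryEquiv.map_smulₛₗ,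
    ContinuousLinearMap.one_def, ContinuousLinearMap.adjoint_id]
  simp

/-! ### Chains of plateau pairs -/

section Chain

variable {w : ℕ → UnitAddTorus d → ℂ}

omit [DecidableEq d] [CompleteSpace V] in
/-- In a plateau pair `χ ψ = χ`. [folklore] -/
theorem _root_.Literature.Analysis.FunctionSpaces.Torus.PlateauPair.mul_eq_left {χ ψ : UnitAddTorus d → ℂ}
    (h : PlateauPair χ ψ) : (fun x => χ x * ψ x) = χ := by
  funext x
  by_cases hx : x ∈ tsupport χ
  · rw [(PlateauPair.eventually_eq_one h hx).self_of_nhds, mul_one]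
  · rw [image_eq_zero_of_notMem_tsupport hx, zero_mul]

omit [DecidableEq d] [CompleteSpace V] in
/-- In a plateau pair `tsupport χ ⊆ tsupport ψ`. [folklore] -/
theorem _root_.Literature.Analysis.FunctionSpaces.Torus.PlateauPair.tsupport_subset {χ ψ : UnitAddTorus d → ℂ}
    (h : PlateauPair χ ψ) : tsupport χ ⊆ tsupport ψ := by
  obtain ⟨U, -, hU, h1⟩ := h.exists_open
  exact fun x hx => subset_tsupport _ (by rw [mem_support, h1 x (hU hx)]; exact one_ne_zero)

omit [DecidableEq d] [CompleteSpace V] in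
/-- Along a chain of plateau pairs the closed supports decrease. [folklore] -/
theorem tsupport_chain_subset (hchain : ∀ j, PlateauPair (w (j + 1)) (w j)) :
    ∀ j, tsupport (w j) ⊆ tsupport (w 0)
  | 0 => subset_rfl
  | j + 1 => (hchain j).tsupport_subset.trans (tsupport_chain_subset hchain j)

/-- In a chain `scal 𝓕ω_{j+1} = scal 𝓕ω_{j+1} ⋆ scal 𝓕ω_j`. [folklore] -/
theorem scal_succ_eq_sconv (hchain : ∀ j, PlateauPair (w (j + 1)) (w j)) (j : ℕ) :
    (scal (mFourierCoeff (w (j + 1))) : (d → ℤ) → (V →L[ℂ] V)) =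
      sconv (scal (mFourierCoeff (w (j + 1)))) (scal (mFourierCoeff (w j))) := by
  rw [sconv_scal_mFourierCoeff (hchain j).smooth_left (hchain j).smooth_right, (hchain j).mul_eq_left]

end Chain

/-! ### The bootstrap -/

section Bootstrap

variable (L : POp d V V) (Lw : ((d → ℤ) → V) → ((d → ℤ) → V))

/-- **Warner's (12): `ω ⋆ (L̃ũ) = ω ⋆ ĝ`** for a real cut-off `ω` whose test functions satisfy the
weak equation (`⟨ũ, Lw 𝓕(ωψ)⟩ = ⟨ĝ, 𝓕(ωψ)⟩` for all smooth `ψ`). [cite: WarnerGTM94, 6.32 (12)] -/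
theorem conv_scal_apply_eq_of_weak
    (hdual : ∀ {u v : (d → ℤ) → V}, Tempered u → RapidDecay v → pairing (L.apply u) v = pairing u (Lw v))
    {û : (d → ℤ) → V} (hu : Tempered û) {ĝ : (d → ℤ) → V} (hg : RapidDecay ĝ)
    {w₀ : UnitAddTorus d → ℂ} (hω : IsSmooth w₀)
    (hreal : adjSymb (scal (mFourierCoeff w₀) : (d → ℤ) → (V →L[ℂ] V)) = scal (mFourierCoeff w₀))
    (hweak : ∀ ψ : UnitAddTorus d → V, IsSmooth ψ →
      pairing û (Lw (mFourierCoeff fun x => w₀ x • ψ x)) = pairing ĝ (mFourierCoeff fun x => w₀ x • ψ x)) :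
    conv (scal (mFourierCoeff w₀)) (L.apply û) = conv (scal (mFourierCoeff w₀)) ĝ := by
  have hs : RapidDecay (scal (mFourierCoeff w₀) : (d → ℤ) → (V →L[ℂ] V)) := hω.rapidDecay_scal
  have hLu : Tempered (L.apply û) := L.tempered_apply hu
  have hA : Tempered (conv (scal (mFourierCoeff w₀)) (L.apply û)) := hLu.conv hs
  have hB : Tempered (conv (scal (mFourierCoeff w₀)) ĝ) := hg.tempered.conv hs
  -- test against an arbitrary rapidly decreasing family
  rw [← sub_eq_zero]
  refine eq_zero_of_forall_pairing_eq_zero fun v hv => ?_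
  obtain ⟨ψ, hψ, hψv⟩ := exists_isSmooth_of_forall_eNormSq_lt_top fun m => eNormSq_lt_top_of_rapidDecay hv m
  have hωψ : IsSmooth fun x => w₀ x • ψ x := hω.smul_complex hψ
  have hconv : conv (scal (mFourierCoeff w₀)) v = mFourierCoeff fun x => w₀ x • ψ x := by
    rw [← hψv, hω.mFourierCoeff_smul_eq_conv_scal hψ]
  rw [pairing_sub_left (summable_inner_of_tempered_rapidDecay hA hv) (summable_inner_of_tempered_rapidDecay hB hv),
    pairing_conv_left' hs hLu hv, pairing_conv_left' hs hg.tempered hv, hreal, hdual hu (hv.conv_right hs), hconv,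
    hweak ψ hψ, sub_self]

/-- **Warner 6.32 (9)–(16): the bootstrap** `v_{j+1} = ω_{j+1} ũ ∈ H_{j+1}`. Let `L` be elliptic with
small principal perturbation, `Lw` an adjoint witness (`⟨L u, v⟩ = ⟨u, Lw v⟩`), `ũ ∈ H₀`, `ĝ`
rapidly decreasing, `ω_j` real smooth cut-offs forming plateau pairs (`ω_j = 1` near
`tsupport ω_{j+1}`), and suppose the weak equation `⟨ũ, Lw ψ̂⟩ = ⟨ĝ, ψ̂⟩` for all smooth `ψ` with
`tsupport ψ ⊆ tsupport w₀`. Then `ω_{j+1} ⋆ ũ ∈ H_{j+1}` for every `j`. [cite: WarnerGTM94, 6.32 (16)] -/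
theorem local_regularity
    (hdual : ∀ {u v : (d → ℤ) → V}, Tempered u → RapidDecay v → pairing (L.apply u) v = pairing u (Lw v))
    {κ : ℝ} (hκ : 0 < κ) (hell : L.IsEllipticWith κ) {ε : ℝ≥0∞} (hpert : L.PrincipalPerturbationLE ε)
    (hε : ENNReal.ofReal (2 * Real.sqrt 2 / κ) * (Fintype.card d : ℝ≥0∞) ^ 2 * ε ≤ 1)
    {û : (d → ℤ) → V} (hu : eNormSq 0 û < ⊤) {ĝ : (d → ℤ) → V} (hg : RapidDecay ĝ)
    {w : ℕ → UnitAddTorus d → ℂ} (hreal : ∀ j, ∃ θ : UnitAddTorus d → ℝ, w j = fun x => (θ x : ℂ))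
    (hchain : ∀ j, PlateauPair (w (j + 1)) (w j))
    (hweak : ∀ ψ : UnitAddTorus d → V, IsSmooth ψ → tsupport ψ ⊆ tsupport (w 0) →
      pairing û (Lw (mFourierCoeff ψ)) = pairing ĝ (mFourierCoeff ψ)) :
    ∀ j : ℕ, eNormSq ((j : ℝ) + 1) (conv (scal (mFourierCoeff (w (j + 1)))) û) < ⊤ := by
  have hut : Tempered û := ⟨0, hu⟩
  have hω : ∀ j, IsSmooth (w j) := fun j => by
    rcases j with _ | j
    · exact (hchain 0).smooth_right
    · exact (hchain j).smooth_left
  have hs : ∀ j, RapidDecay (scal (mFourierCoeff (w j)) : (d → ℤ) → (V →L[ℂ] V)) := fun j => (hω j).rapidDecay_scal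
  have hrealS : ∀ j, adjSymb (scal (mFourierCoeff (w j)) : (d → ℤ) → (V →L[ℂ] V)) = scal (mFourierCoeff (w j)) :=
    fun j => by obtain ⟨θ, hθ⟩ := hreal j; rw [hθ]; exact adjSymb_scal_ofReal θ
  -- (12) for every member of the chain
  have h12 : ∀ j, conv (scal (mFourierCoeff (w j))) (L.apply û) = conv (scal (mFourierCoeff (w j))) ĝ := fun j =>
    conv_scal_apply_eq_of_weak L Lw hdual hut hg (hω j) (hrealS j) fun ψ hψ =>
      hweak _ ((hω j).smul_complex hψ) (((tsupport_smul_subset_left _ _).trans (tsupport_chain_subset hchain j)))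
  -- the commutators
  set Comm : ℕ → POp1 d V V := fun j => L.cutoffComm (mFourierCoeff (w j)) (hω j).rapidDecay_mFourierCoeff with hComm
  -- `L v_j = ω_j ⋆ ĝ + Comm_j û`
  have hLv : ∀ j, L.apply (conv (scal (mFourierCoeff (w j))) û) = conv (scal (mFourierCoeff (w j))) ĝ + (Comm j).apply û :=
    fun j => by rw [L.apply_conv_scal (hω j).rapidDecay_mFourierCoeff hut, h12 j]
  -- induction
  intro j
  induction j with
  | zero =>
      -- `v_1 ∈ H_0`, `L v_1 ∈ H_{-1}`
      have h0 : eNormSq 0 (conv (scal (mFourierCoeff (w 1))) û) < ⊤ := eNormSq_conv_lt_top (hs 1) hu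
      have hL1 : eNormSq (-1) (L.apply (conv (scal (mFourierCoeff (w 1))) û)) < ⊤ := by
        rw [hLv 1]
        refine (eNormSq_add_le _ _ _).trans_lt (ENNReal.add_lt_top.2 ⟨ENNReal.mul_lt_top (by norm_num)
          (eNormSq_lt_top_of_rapidDecay ((hg.conv_right (hs 1))) _), ENNReal.mul_lt_top (by norm_num) ?_⟩)
        rw [← eNorm_lt_top_iff]
        refine (POp1.eNorm_apply_le (Comm 1) (-1) û).trans_lt (ENNReal.mul_lt_top (POp1.bound_lt_top _ _) ?_)
        rw [show (-1 : ℝ) + 1 = 0 by norm_num, eNorm_lt_top_iff]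
        exact hu
      simpa using L.regularity_zero hκ hell hpert hε h0 hL1
  | succ j ih =>
      -- `v_{j+2} = ω_{j+2} ⋆ v_{j+1} ∈ H_{j+1}`
      have hv : conv (scal (mFourierCoeff (w (j + 2)))) û =
          conv (scal (mFourierCoeff (w (j + 2)))) (conv (scal (mFourierCoeff (w (j + 1)))) û) := by
        rw [conv_conv (hs (j + 2)) (hs (j + 1)) hut, ← scal_succ_eq_sconv hchain (j + 1)]
      have hlev : eNormSq ((j : ℝ) + 1) (conv (scal (mFourierCoeff (w (j + 2)))) û) < ⊤ := by
        rw [hv]; exact eNormSq_conv_lt_top (hs (j + 2)) ih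
      -- `L v_{j+2} = ω_{j+2} ⋆ ĝ + Comm_{j+2} v_{j+1} ∈ H_j`
      have hcomm : (Comm (j + 2)).apply û = (Comm (j + 2)).apply (conv (scal (mFourierCoeff (w (j + 1)))) û) :=
        (POp.cutoffComm_apply_conv_scal_eq L (hchain (j + 1)) hut).symm
      have hLj : eNormSq ((j : ℝ) + 1 - 1) (L.apply (conv (scal (mFourierCoeff (w (j + 2)))) û)) < ⊤ := by
        rw [hLv (j + 2), hcomm]
        refine (eNormSq_add_le _ _ _).trans_lt (ENNReal.add_lt_top.2 ⟨ENNReal.mul_lt_top (by norm_num)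
          (eNormSq_lt_top_of_rapidDecay ((hg.conv_right (hs (j + 2)))) _), ENNReal.mul_lt_top (by norm_num) ?_⟩)
        rw [← eNorm_lt_top_iff]
        refine (POp1.eNorm_apply_le (Comm (j + 2)) _ _).trans_lt (ENNReal.mul_lt_top (POp1.bound_lt_top _ _) ?_)
        rw [show (j : ℝ) + 1 - 1 + 1 = (j : ℝ) + 1 by ring, eNorm_lt_top_iff]
        exact ih
      have := L.regularity hκ hell hpert hε (j + 1) _ (by exact_mod_cast hlev) (by exact_mod_cast hLj)
      exact_mod_cast this

/-- **Smoothness on the final plateau** (Warner 6.32, after (16): "`ωũ ∈ H_n` for every `n` … by the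
corollary to the Sobolev lemma `ωũ` represents a `C^∞` function"): for a real cut-off `wInf` with
`PlateauPair wInf (ω_j)` for all `j`, `wInf ⋆ ũ` is the coefficient family of a smooth function.
[cite: WarnerGTM94, 6.32] -/
theorem exists_isSmooth_plateau_conv
    (hdual : ∀ {u v : (d → ℤ) → V}, Tempered u → RapidDecay v → pairing (L.apply u) v = pairing u (Lw v))
    {κ : ℝ} (hκ : 0 < κ) (hell : L.IsEllipticWith κ) {ε : ℝ≥0∞} (hpert : L.PrincipalPerturbationLE ε)
    (hε : ENNReal.ofReal (2 * Real.sqrt 2 / κ) * (Fintype.card d : ℝ≥0∞) ^ 2 * ε ≤ 1)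
    {û : (d → ℤ) → V} (hu : eNormSq 0 û < ⊤) {ĝ : (d → ℤ) → V} (hg : RapidDecay ĝ)
    {w : ℕ → UnitAddTorus d → ℂ} (hreal : ∀ j, ∃ θ : UnitAddTorus d → ℝ, w j = fun x => (θ x : ℂ))
    (hchain : ∀ j, PlateauPair (w (j + 1)) (w j))
    (hweak : ∀ ψ : UnitAddTorus d → V, IsSmooth ψ → tsupport ψ ⊆ tsupport (w 0) →
      pairing û (Lw (mFourierCoeff ψ)) = pairing ĝ (mFourierCoeff ψ))
    {wInf : UnitAddTorus d → ℂ} (hpl : ∀ j, PlateauPair wInf (w j)) :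
    ∃ u₀ : UnitAddTorus d → V, IsSmooth u₀ ∧ mFourierCoeff u₀ = conv (scal (mFourierCoeff wInf)) û := by
  have hut : Tempered û := ⟨0, hu⟩
  have hreg := local_regularity L Lw hdual hκ hell hpert hε hu hg hreal hchain hweak
  have hwInf : IsSmooth wInf := (hpl 0).smooth_left
  have hsInf : RapidDecay (scal (mFourierCoeff wInf) : (d → ℤ) → (V →L[ℂ] V)) := hwInf.rapidDecay_scal
  have hs : ∀ j, IsSmooth (w j) := fun j => (hpl j).smooth_right
  refine exists_isSmooth_of_forall_eNormSq_lt_top fun m => ?_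
  -- `wInf ⋆ û = wInf ⋆ (ω_{m+1} ⋆ û) ∈ H_{m+1} ⊆ H_m`
  have hv : conv (scal (mFourierCoeff wInf)) û =
      conv (scal (mFourierCoeff wInf)) (conv (scal (mFourierCoeff (w (m + 1)))) û) := by
    rw [conv_conv hsInf (hs (m + 1)).rapidDecay_scal hut, sconv_scal_mFourierCoeff hwInf (hs (m + 1)),
      (hpl (m + 1)).mul_eq_left]
  rw [hv]
  exact (eNormSq_mono (by linarith) _).trans_lt (eNormSq_conv_lt_top hsInf (hreg m))

end Bootstrap

end Lattice

end Literature.Analysis.FunctionSpaces
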